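import Summits.QuantumFields.YangMills.Theorems.BalabanUVNodesN12AtRecord13OfResiduals
import Literature.MathematicalPhysics.QuantumFieldTheory.Balaban1983to89.Node00.Record13CarriersSep

/-!
# BalabanUVNodes ∕ N12 — N12's STAGE-13 ROWS AND SOCKETS RE-KEYED TO node00-def-T's v1.2 RECORD (`Provisos₁₃Core` ∕ `Provisos₁₃Sep`, `datumOfRecord₁₃Sep`,
# `IsRecordOfRecord₁₃CSep`) — THE ⁗ EDITION (Track A, DAG node N12 = [B15, Balaban1989LargeFieldI] CMP **122** (1989) 175–202; cluster K1⁗ `StabilityBAtRecordR13Sep`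
# = stmt-QuantumFields-20290 (route rev 18∕19, plan KEY-18, dag-lead WORDS-140); seat `pub-ymgap-dag-n12-d` g8 (R134 s2 «knit at the record»; HANDOFF trigger t22),
# 2026-08-27; count-neutral, NOT a discharge)

HONEST FRAMING.  Count-neutral kernel RE-KEYING BY NAME under dag-lead's token map (WORDS-140 (2): `θ.Provisos₁₃ ↦ θ.Provisos₁₃Sep`, `datumOfRecord₁₃ ↦ datumOfRecord₁₃Sep`,
`IsRecordOfRecord₁₃C ↦ IsRecordOfRecord₁₃CSep`; bg-BLIND rows key on the consumer key `Provisos₁₃Core` and serve BOTH editions at `h.toCore`) over node00-def-T's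
`Node00/Record13` v1.2 (p501191: `Stage13Params.Provisos₁₃Core ∕ Provisos₁₃Sep`, `datumOfRecord₁₃Sep`, `IsRecordOfRecord₁₃CSep`), dag-n10-d's `Node00/Record13CarriersSep`
(p502304), this seat's modules 12A `…N12LeafIntAtRecord13` (§2: the generic-`θ` [IV] rows, ‴-keyed) and 12E `…N12AtRecord13OfResiduals` (§1: the proviso-FREE rows at a live
re-pin carrying K0b's residuals).  N12's rows read of the record ONLY def-R's integrable (0.3) provisos `rstep` (and, at a live re-pin, nothing: 12E) — NEVER row P11 `bg`, the one
row v1.2 guards — so the re-key is purely nominal: §1 keys 12A's four generic-`θ` rows on the bg-free CORE (`(hc : θ.Provisos₁₃Core F N)`; instances at `h.toCore` from a ‴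
`Provisos₁₃` AND from a ⁗ `Provisos₁₃Sep`), §2 states the ⁗-keyed corollaries a closer at a v1.2 record calls by name.  Nothing of Bałaban's is asserted or proved; NO estimate;
the (1.100) pin equation, the denominator masses ∕ live-mass, the fibre witness, Proposition 1 (1.78), (1.80), (1.89) stay DISPLAYED exactly as in 12A ∕ 12E; N12 is NOT
discharged; counts unmoved (Track A discharged 5∕28).  ONE finite four-torus programme at fixed `ε = L^{-K}` — nothing continuum ∕ ℝ⁴ ∕ OS ∕ mass gap ∕ Clay.

WHAT THIS FILE GIVES (all count-neutral; every input LANDED — no dag-n24-c four-pin ⁗ socket is consumed here, those compose in the successor module once 40⁗∕41⁗ land):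
* §1 CORE-KEYED GENERIC-`θ` ROWS: `provisosInt_reprTOfRecord₁₃_of_provisos₁₃Core` (def-T's core row `rstep` IS def-R's Int provisos of the N12 knit datum at `Tstep rep_k` of record),
  `normalization1102_reprTOfRecord₁₃_of_provisos₁₃Core` ((1.102) for `𝐓ρ_k` of record from the core alone), ★ `b15Leaf_WOfRecord₁₃_of_massSel_core` (the [IV] leaf at the Stage-13 bundle
  of record of ANY `θ` with core provisos, `kSel P < K`, from the pin equation + denominator masses + fibre witness + Prop. 1 + (1.80) + (1.89)), `rBasicStep_view₁₃B10YZW_of_massSel_core`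
  (the `rBasicStep` leaf of dag-n10-d's four-pin view); the ‴ originals of 12A §2 are these at `hP.toCore`.
* §2 ⁗-KEYED COROLLARIES: `b15Leaf_WOfRecord₁₃_of_massSel_sep` ∕ `rBasicStep_view₁₃B10YZW_of_massSel_sep` (`(hP : θ.Provisos₁₃Sep F N)`, §1 at `hP.toCore`).
* §3 N12's ₁₃ STOREY IN THE v1.2 VOCABULARY (the N12 twin of dag-n10-d's `…N10AtRecord13SepB13` ∕ dag-n08-c's `…N08AtRecord13Sep`): `exists_record₁₃CSep_pinWWorld_b15_main_of_leaf` (for every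
  admissible `θ` with `h : Provisos₁₃Sep` and ANY per-run [IV] bundle family `W₀` with the leaf, the world bound at the C-binding of `(θ.pinW W₀).toStage5₁₃` is an `IsRecordOfRecord₁₃CSep`
  record of `datumOfRecord₁₃Sep θ h` with `Dag.B15_main` at every run — HONESTY: junk-inhabitable at a degenerate `W₀`, kernel census `exists_pinWWorld_b15_main_degenerate` from this seat's
  g4 `exists_printedCarriers15_b15Leaf`),
  `…_of_leafOfRecord` (W READ AT THE BUNDLE OF RECORD `WOfRecord₁₃ θ λ`, the row handed), `…_toSep` (a ‴-keyed `h`), ★ `exists_record₁₃CSep_pinWWorld_b15_main_liveRepin₁₃_of_massLive_of_hasResiduals`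
  (at the ₁₃ live re-pin of a `Θ` carrying K0b's residuals, N12's row from its PER-RUN DISPLAYS by 12E), ★★ `exists_guarded_record₁₃CSep_b15_main_liveRepin₁₃_of_massLive_of_hasResiduals`
  (the rung-1 ∃-shape of plan g67's `K1Skeleton13Sep.stub_nodes13P` RESTRICTED TO N12's CONJUNCT, guard a THEOREM of K0b ∕ K0a FILE 9 v1.1 — no proviso read), ★★★
  `exists_guarded_record₁₃CSep_b15_main_theta13OfThm1C_of_massLive` (the same at the plan's witness `θ₁₅ᶜ`: K1⁗-side input `h : Provisos₁₃Sep θ₁₅ᶜ` ALONE).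
WHAT N12 THEN COSTS per run at a v1.2 record (typing strength, NOT a second gap; unchanged from 12E ∕ 12F): live-mass at level `kSel P + 1` (NODE 00), Prop. 1 at `λ.LF P`, (1.80) ∕ (1.89) at
`λ.D189 P` (or their pinned discharges of 14C ∕ 12F), the (1.100) pin equation (`rfl` at `λ.pinRPrime₁₃ θ`), and on runs with `K ≤ kSel P` the leaf itself.

Sources: [Balaban1989LargeFieldI] (0.2)–(0.6) p.176, p.176 ll.14–16, Prop. 1 (1.78) p.194, (1.80) p.195, (1.89) p.198, (1.99)–(1.102) pp.200–201; [Balaban1988Convergent] (2.18) p.257,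
(3.25) p.270; [Balaban1989LargeFieldII] Thm 1 + (0.1) pp.355–356 (the record; bookkeeping).
-/

noncomputable section

open MeasureTheory
open scoped Matrix.Norms.L2Operator

namespace Summit.QuantumFields.YangMills.BalabanUVNodes.N12AtRecord13Sep

open Literature.MathematicalPhysics.QuantumFieldTheory.Balaban1983to89
open Literature.MathematicalPhysics.QuantumFieldTheory.Balaban1983to89.T4Continuum (T4Family)
open Literature.MathematicalPhysics.QuantumFieldTheory.Balaban1983to89.DagBinding
open Literature.MathematicalPhysics.QuantumFieldTheory.Balaban1983to89.Node00
open B15Claim189Assembly (new189 chiPP dom)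
open B15 (Prop1Printed Ineq180)
open B15.BasicStep (Claim189)
open B15Sect1Statements (Normalization1102)
open B8Eq17ClassAkV1 (plaqsOf)
open B15RPrime1100OfRep (rPrimeDataOfSel)
open Summit.QuantumFields.YangMills.BalabanUVNodes.N12LeafIntAtRecord13 (normalization1102_rPrimeDataOfSel_int b15Leaf_WOfRecord₁₃_of_provisosInt_massSel)

variable {N : ℕ} [NeZero N] {F : T4Family}

/-! ## §1 THE GENERIC-`θ` [IV] ROWS OF RECORD ON node00-def-T's bg-FREE CONSUMER KEY `Provisos₁₃Core` (serves ‴ and ⁗ at `h.toCore`) -/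

section Core
variable (θ : Stage13Params F N) (lam : ResidW F N)

/-- **def-T's CORE row `Provisos₁₃Core.rstep P k` IS def-R's INTEGRABLE-form provisos of the N12 knit datum at `Tstep rep_k` of record, Stage 13** (12A's
`provisosInt_reprTOfRecord₁₃_of_provisos₁₃` on the bg-free core; def-R's `rfl` bridge `toRepData_towerRepOfRecord_eq`). [cite: Balaban1989LargeFieldI, (0.3) p.176; Balaban1988Convergent, (3.25) p.270 (bookkeeping)] -/
theorem provisosInt_reprTOfRecord₁₃_of_provisos₁₃Core (hc : θ.Provisos₁₃Core F N) (P : B12.RunParams) (k : ℕ) [DecidableEq (PBond (F.P P.K) (k + 1))] (hk : k < P.K) :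
    (repDataOfSel (reprTOfRecord₁₃ F N θ P k) (θ.ppSel P (gOfRecord₁₃ F N θ P) (k + 1))
      (fibOfSeq F θ.ν θ.τ9 P (gOfRecord₁₃ F N θ P) (k + 1))).ProvisosInt := by
  have h := hc.rstep P k hk
  rw [toRepData_towerRepOfRecord_eq] at h
  exact h

/-- **(1.102) FOR `𝐓ρ_k` OF RECORD, Stage 13, at the 𝐑-step's (1.100)-reading, FROM THE CORE PROVISOS ALONE** (`k < K`): 12A's `normalization1102_rPrimeDataOfSel_int` fed by the core
row `rstep` (`Σ_s t_s = tdensOfRecord₁₃ θ P k` is `rfl`). [cite: Balaban1989LargeFieldI, (1.102) p.201, (0.4) p.176; Balaban1988Convergent, (3.25) p.270] -/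
theorem normalization1102_reprTOfRecord₁₃_of_provisos₁₃Core (hc : θ.Provisos₁₃Core F N) (P : B12.RunParams) (k : ℕ) [DecidableEq (PBond (F.P P.K) (k + 1))]
    (hk : k < P.K) :
    Normalization1102
      (rPrimeDataOfSel (reprTOfRecord₁₃ F N θ P k) (θ.ppSel P (gOfRecord₁₃ F N θ P) (k + 1)) (fibOfSeq F θ.ν θ.τ9 P (gOfRecord₁₃ F N θ P) (k + 1)))
      (tdensOfRecord₁₃ F N θ P k) :=
  normalization1102_rPrimeDataOfSel_int _ _ _ (provisosInt_reprTOfRecord₁₃_of_provisos₁₃Core θ hc P k hk)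

/-- **★ THE [IV] LEAF AT THE STAGE-13 BUNDLE OF RECORD OF ANY `θ` WITH CORE PROVISOS** (`kSel P < P.K`): def-T's core row `rstep` (integrable form) supplies the knit datum's provisos AND
(1.102) at the pin; displayed: the (1.100) pin equation at the ₁₃ tower, the denominator masses, the fibre witness, and EXACTLY Proposition 1 (1.78), (1.80), (1.89) — 12A's ★★
`b15Leaf_WOfRecord₁₃_of_massSel` on the bg-free core, hence available at a ‴ record (`hP.toCore`) AND at a v1.2 ⁗ record (`hP.toCore`, §2).
[cite: Balaban1989LargeFieldI, (0.2)–(0.6) p.176, p.176 ll.14–16, Prop. 1 (1.78) p.194, (1.80) p.195, (1.89) p.198, (1.99)–(1.102) pp.200–201; Balaban1988Convergent, (3.25) p.270] -/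
theorem b15Leaf_WOfRecord₁₃_of_massSel_core (hc : θ.Provisos₁₃Core F N) {P : B12.RunParams} (hk : lam.kSel P < P.K)
    (hpin : lam.D1100 P
      = rPrimeDataOfSel (reprTOfRecord₁₃ F N θ P (lam.kSel P)) (θ.ppSel P (gOfRecord₁₃ F N θ P) (lam.kSel P + 1))
          (fibOfSeq F θ.ν θ.τ9 P (gOfRecord₁₃ F N θ P) (lam.kSel P + 1)))
    (hmassSel : ∀ s, 0 < ∫ V, rterm (reprTOfRecord₁₃ F N θ P (lam.kSel P)) (θ.ppSel P (gOfRecord₁₃ F N θ P) (lam.kSel P + 1) s) V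
      ∂(fieldMeasure (F.P P.K) (lam.kSel P + 1) (SU N)))
    (hfib : ∀ s, ∃ s', θ.ppSel P (gOfRecord₁₃ F N θ P) (lam.kSel P + 1) s' = θ.ppSel P (gOfRecord₁₃ F N θ P) (lam.kSel P + 1) s ∧
      0 < ∫ V, rterm (reprTOfRecord₁₃ F N θ P (lam.kSel P)) s' V ∂(fieldMeasure (F.P P.K) (lam.kSel P + 1) (SU N)))
    (hP1 : Prop1Printed (lam.LF P))
    (h180 : ∀ U, new189 (lam.D189 P) U → ∀ i, (lam.D189 P).h ≤ i → i ≤ (lam.D189 P).k → ∀ q ∈ plaqsOf (dom (lam.D189 P) i),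
      Ineq180 ((lam.D189 P).dev0 U q) ((lam.D189 P).ε (lam.D189 P).k) (lam.D189 P).η (lam.D189 P).B₃ (lam.D189 P).B₅ (lam.D189 P).M (lam.D189 P).δ
        ((lam.D189 P).dist q) (lam.D189 P).O1)
    (h189 : Claim189 (new189 (lam.D189 P)) (chiPP (lam.D189 P))) : B15Leaf (WOfRecord₁₃ F N θ lam P) :=
  b15Leaf_WOfRecord₁₃_of_provisosInt_massSel θ lam (provisosInt_reprTOfRecord₁₃_of_provisos₁₃Core θ hc P (lam.kSel P) hk)
    hpin hmassSel hfib hP1 h180 h189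

/-- **THE `rBasicStep` LEAF OF dag-n10-d's FOUR-PIN STAGE-13 VIEW `θ.view₁₃B10YZW Mstar ops ζ λ`** at run `P` from the same displays, core-keyed (his `upOfRecord₅C_view₁₃B10YZW_leaves`,
first conjunct, is the `Iff` with `B15Leaf (WOfRecord₁₃ θ λ P)`). [cite: Balaban1989LargeFieldI, (0.2)–(0.6) p.176, Prop. 1 (1.78) p.194, (1.80) p.195, (1.89) p.198, (1.99)–(1.102) pp.200–201; Balaban1989LargeFieldII, Thm 1 + (0.1) pp.355–356] -/
theorem rBasicStep_view₁₃B10YZW_of_massSel_core (hc : θ.Provisos₁₃Core F N) (Mstar : ℕ) (ops : OpsY N θ.toStage3Params Mstar) (ζ : ResidZ F N)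
    {P : B12.RunParams} (hk : lam.kSel P < P.K)
    (hpin : lam.D1100 P
      = rPrimeDataOfSel (reprTOfRecord₁₃ F N θ P (lam.kSel P)) (θ.ppSel P (gOfRecord₁₃ F N θ P) (lam.kSel P + 1))
          (fibOfSeq F θ.ν θ.τ9 P (gOfRecord₁₃ F N θ P) (lam.kSel P + 1)))
    (hmassSel : ∀ s, 0 < ∫ V, rterm (reprTOfRecord₁₃ F N θ P (lam.kSel P)) (θ.ppSel P (gOfRecord₁₃ F N θ P) (lam.kSel P + 1) s) V
      ∂(fieldMeasure (F.P P.K) (lam.kSel P + 1) (SU N)))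
    (hfib : ∀ s, ∃ s', θ.ppSel P (gOfRecord₁₃ F N θ P) (lam.kSel P + 1) s' = θ.ppSel P (gOfRecord₁₃ F N θ P) (lam.kSel P + 1) s ∧
      0 < ∫ V, rterm (reprTOfRecord₁₃ F N θ P (lam.kSel P)) s' V ∂(fieldMeasure (F.P P.K) (lam.kSel P + 1) (SU N)))
    (hP1 : Prop1Printed (lam.LF P))
    (h180 : ∀ U, new189 (lam.D189 P) U → ∀ i, (lam.D189 P).h ≤ i → i ≤ (lam.D189 P).k → ∀ q ∈ plaqsOf (dom (lam.D189 P) i),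
      Ineq180 ((lam.D189 P).dev0 U q) ((lam.D189 P).ε (lam.D189 P).k) (lam.D189 P).η (lam.D189 P).B₃ (lam.D189 P).B₅ (lam.D189 P).M (lam.D189 P).δ
        ((lam.D189 P).dist q) (lam.D189 P).O1)
    (h189 : Claim189 (new189 (lam.D189 P)) (chiPP (lam.D189 P))) :
    (upOfRecord₅C F N (θ.view₁₃B10YZW F N Mstar ops ζ lam) P).rBasicStep :=
  (upOfRecord₅C_view₁₃B10YZW_leaves F N θ Mstar ops ζ lam P).1.2
    (b15Leaf_WOfRecord₁₃_of_massSel_core θ lam hc hk hpin hmassSel hfib hP1 h180 h189)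

end Core

/-! ## §2 THE ⁗-KEYED COROLLARIES (`(hP : θ.Provisos₁₃Sep F N)`, at `hP.toCore`) — what a closer at a v1.2 record calls by name -/

section Sep
variable (θ : Stage13Params F N) (lam : ResidW F N)

/-- **★ THE [IV] LEAF AT THE STAGE-13 BUNDLE OF RECORD FROM THE v1.2 PROVISOS `Provisos₁₃Sep`** (`kSel P < P.K`; §1 at `hP.toCore` — row P11's separation ∕ partition guard is never
read by N12): the ⁗ twin of 12A ★★ `b15Leaf_WOfRecord₁₃_of_massSel`. [cite: Balaban1989LargeFieldI, (0.2)–(0.6) p.176, p.176 ll.14–16, Prop. 1 (1.78) p.194, (1.80) p.195, (1.89) p.198, (1.99)–(1.102) pp.200–201; Balaban1988Convergent, (3.25) p.270] -/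
theorem b15Leaf_WOfRecord₁₃_of_massSel_sep (hP : θ.Provisos₁₃Sep F N) {P : B12.RunParams} (hk : lam.kSel P < P.K)
    (hpin : lam.D1100 P
      = rPrimeDataOfSel (reprTOfRecord₁₃ F N θ P (lam.kSel P)) (θ.ppSel P (gOfRecord₁₃ F N θ P) (lam.kSel P + 1))
          (fibOfSeq F θ.ν θ.τ9 P (gOfRecord₁₃ F N θ P) (lam.kSel P + 1)))
    (hmassSel : ∀ s, 0 < ∫ V, rterm (reprTOfRecord₁₃ F N θ P (lam.kSel P)) (θ.ppSel P (gOfRecord₁₃ F N θ P) (lam.kSel P + 1) s) V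
      ∂(fieldMeasure (F.P P.K) (lam.kSel P + 1) (SU N)))
    (hfib : ∀ s, ∃ s', θ.ppSel P (gOfRecord₁₃ F N θ P) (lam.kSel P + 1) s' = θ.ppSel P (gOfRecord₁₃ F N θ P) (lam.kSel P + 1) s ∧
      0 < ∫ V, rterm (reprTOfRecord₁₃ F N θ P (lam.kSel P)) s' V ∂(fieldMeasure (F.P P.K) (lam.kSel P + 1) (SU N)))
    (hP1 : Prop1Printed (lam.LF P))
    (h180 : ∀ U, new189 (lam.D189 P) U → ∀ i, (lam.D189 P).h ≤ i → i ≤ (lam.D189 P).k → ∀ q ∈ plaqsOf (dom (lam.D189 P) i),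
      Ineq180 ((lam.D189 P).dev0 U q) ((lam.D189 P).ε (lam.D189 P).k) (lam.D189 P).η (lam.D189 P).B₃ (lam.D189 P).B₅ (lam.D189 P).M (lam.D189 P).δ
        ((lam.D189 P).dist q) (lam.D189 P).O1)
    (h189 : Claim189 (new189 (lam.D189 P)) (chiPP (lam.D189 P))) : B15Leaf (WOfRecord₁₃ F N θ lam P) :=
  b15Leaf_WOfRecord₁₃_of_massSel_core θ lam hP.toCore hk hpin hmassSel hfib hP1 h180 h189

/-- **THE `rBasicStep` LEAF OF THE FOUR-PIN STAGE-13 VIEW FROM THE v1.2 PROVISOS** (§1 at `hP.toCore`). [cite: Balaban1989LargeFieldI, (0.2)–(0.6) p.176, Prop. 1 (1.78) p.194, (1.80) p.195, (1.89) p.198, (1.99)–(1.102) pp.200–201; Balaban1989LargeFieldII, Thm 1 + (0.1) pp.355–356] -/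
theorem rBasicStep_view₁₃B10YZW_of_massSel_sep (hP : θ.Provisos₁₃Sep F N) (Mstar : ℕ) (ops : OpsY N θ.toStage3Params Mstar) (ζ : ResidZ F N)
    {P : B12.RunParams} (hk : lam.kSel P < P.K)
    (hpin : lam.D1100 P
      = rPrimeDataOfSel (reprTOfRecord₁₃ F N θ P (lam.kSel P)) (θ.ppSel P (gOfRecord₁₃ F N θ P) (lam.kSel P + 1))
          (fibOfSeq F θ.ν θ.τ9 P (gOfRecord₁₃ F N θ P) (lam.kSel P + 1)))
    (hmassSel : ∀ s, 0 < ∫ V, rterm (reprTOfRecord₁₃ F N θ P (lam.kSel P)) (θ.ppSel P (gOfRecord₁₃ F N θ P) (lam.kSel P + 1) s) V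
      ∂(fieldMeasure (F.P P.K) (lam.kSel P + 1) (SU N)))
    (hfib : ∀ s, ∃ s', θ.ppSel P (gOfRecord₁₃ F N θ P) (lam.kSel P + 1) s' = θ.ppSel P (gOfRecord₁₃ F N θ P) (lam.kSel P + 1) s ∧
      0 < ∫ V, rterm (reprTOfRecord₁₃ F N θ P (lam.kSel P)) s' V ∂(fieldMeasure (F.P P.K) (lam.kSel P + 1) (SU N)))
    (hP1 : Prop1Printed (lam.LF P))
    (h180 : ∀ U, new189 (lam.D189 P) U → ∀ i, (lam.D189 P).h ≤ i → i ≤ (lam.D189 P).k → ∀ q ∈ plaqsOf (dom (lam.D189 P) i),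
      Ineq180 ((lam.D189 P).dev0 U q) ((lam.D189 P).ε (lam.D189 P).k) (lam.D189 P).η (lam.D189 P).B₃ (lam.D189 P).B₅ (lam.D189 P).M (lam.D189 P).δ
        ((lam.D189 P).dist q) (lam.D189 P).O1)
    (h189 : Claim189 (new189 (lam.D189 P)) (chiPP (lam.D189 P))) :
    (upOfRecord₅C F N (θ.view₁₃B10YZW F N Mstar ops ζ lam) P).rBasicStep :=
  rBasicStep_view₁₃B10YZW_of_massSel_core θ lam hP.toCore Mstar ops ζ hk hpin hmassSel hfib hP1 h180 h189

end Sep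

/-! ## §3 N12's ₁₃ STOREY IN THE v1.2 VOCABULARY — «an `IsRecordOfRecord₁₃CSep` record of θ's OWN `datumOfRecord₁₃Sep` with `Dag.B15_main` at every run» at the C-binding of the
W-PINNED Stage-13 view, W READ AT THE BUNDLE OF RECORD; at a live re-pin carrying K0b's residuals N12's row from its per-run displays and the guard a THEOREM -/

section Storey
variable (θ : Stage13Params F N)

/-- **FOR EVERY ADMISSIBLE STAGE-13 PACKAGE WITH THE v1.2 PROVISOS AND ANY PER-RUN [IV] BUNDLE FAMILY `W₀` CARRYING THE LEAF, THE WORLD BOUND AT THE C-BINDING OF THE W-PINNED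
STAGE-13 VIEW IS A v1.2 ₁₃C RECORD OF θ's OWN v1.2 DATUM WITH `Dag.B15_main` AT EVERY RUN** (any window `γw ∈ ]0, θ.γ]`, block size `θ.L`; the pin is UP-SIDE — dag-n10-d's
`Provisos₁₃Sep.pinW`, `datumOfRecord₁₃Sep_pinW : rfl`, `pinW_admissible_iff`, node00-def-T's eight-tuple `IsRecordOfRecord₁₃CSep`; N12 reads `W₀` there: g30's
`upOfRecord₅C_pinW_rBasicStep_iff` along `toStage5₁₃_pinW`).  HONESTY (R433 species, this seat's g4 `exists_printedCarriers15_b15Leaf`): at a GENERIC `W₀` the leaf is junk-inhabitable —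
the contentful instances read `W₀ := WOfRecord₁₃ θ λ` (below).  N12's conjunct of the rev-18 K1-class item modulo the leaf and the other nodes at the SAME world; count-neutral.
[cite: Balaban1989LargeFieldI, (0.2)–(0.6) p.176, Prop. 1 p.194; Balaban1989LargeFieldII, Thm 1 + (0.1) pp.355–356 (the record, separated range; bookkeeping)] -/
theorem exists_record₁₃CSep_pinWWorld_b15_main_of_leaf (h : θ.Provisos₁₃Sep F N) (hθ : θ.Admissible F N) (W₀ : B12.RunParams → PrintedCarriers15)
    {γw : ℝ} (hγw : 0 < γw ∧ γw ≤ θ.γ) (hleaf : ∀ P, B15Leaf (W₀ P)) :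
    ∃ w : WorldP, IsRecordOfRecord₁₃CSep F N (datumOfRecord₁₃Sep F N θ h) w ∧ w.γ = γw ∧ w.L = (θ.L : ℝ) ∧
      (∀ P, w.up P = upOfRecord₅C F N ((θ.pinW F N W₀).toStage5₁₃ F N) P) ∧ ∀ P : B12.RunParams, Dag.B15_main (leavesP w P) := by
  obtain ⟨w₀⟩ := nonempty_worldP
  let w : WorldP :=
    { w₀ with
      C := (datumOfRecord₁₃Sep F N θ h).C, γ := γw, L := (θ.L : ℝ), one_lt_L := by exact_mod_cast θ.hL.2,
      up := fun P => upOfRecord₅C F N ((θ.pinW F N W₀).toStage5₁₃ F N) P }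
  refine ⟨w, ⟨θ.pinW F N W₀, h.pinW W₀, (Stage13Params.pinW_admissible_iff F N θ W₀).2 hθ, (datumOfRecord₁₃Sep_pinW F N θ h W₀).symm, rfl, hγw, rfl,
    fun _ => rfl⟩, rfl, rfl, fun _ => rfl, fun P => ?_⟩
  exact B15LeafKnit.b15_main_of_up (U := upOfRecord₅C F N ((θ.pinW F N W₀).toStage5₁₃ F N) P) rfl
    ((upOfRecord₅C_pinW_rBasicStep_iff F N (θ.toStage5₁₃ F N) W₀ P).2 (hleaf P))

/-- **CENSUS (R433 species, kernel form): THE GENERIC-`W₀` STOREY IS JUNK-INHABITABLE AT EVERY ADMISSIBLE v1.2 PACKAGE** — a DEGENERATE [IV] bundle carries `B15Leaf` (this seat's g4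
`exists_printedCarriers15_b15Leaf`: empty index, empty Proposition-1 carrier, trivial (1.89) ∕ (1.102) letters), so SOME `W₀` presents a v1.2 record of `datumOfRecord₁₃Sep θ h` with `Dag.B15_main` at
every run WITHOUT any [IV] input.  Hence only the forms with W read AT THE BUNDLE OF RECORD (below) measure N12. [cite: Balaban1989LargeFieldI, (0.2) p.176, Prop. 1 p.194 (bookkeeping: the typed conjuncts read the carrier)] -/
theorem exists_pinWWorld_b15_main_degenerate (h : θ.Provisos₁₃Sep F N) (hθ : θ.Admissible F N) {γw : ℝ} (hγw : 0 < γw ∧ γw ≤ θ.γ) :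
    ∃ (W₀ : B12.RunParams → PrintedCarriers15) (w : WorldP), IsRecordOfRecord₁₃CSep F N (datumOfRecord₁₃Sep F N θ h) w ∧ w.γ = γw ∧ w.L = (θ.L : ℝ) ∧
      (∀ P, w.up P = upOfRecord₅C F N ((θ.pinW F N W₀).toStage5₁₃ F N) P) ∧ ∀ P : B12.RunParams, Dag.B15_main (leavesP w P) := by
  obtain ⟨W, hW⟩ := N12AtRecord12Pointed.exists_printedCarriers15_b15Leaf (F.P 0)
  exact ⟨fun _ => W, exists_record₁₃CSep_pinWWorld_b15_main_of_leaf θ h hθ (fun _ => W) hγw fun _ => hW⟩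

/-- **… W READ AT THE BUNDLE OF RECORD `WOfRecord₁₃ θ λ`** (dag-n10-d's `Record13Carriers.WOfRecord₁₃`: n12-a's `WOfRepr` at `Tstep rep_k` of record, the selector and the fibres
along the ₁₃ histories): the N12 row HANDED run by run. [cite: Balaban1989LargeFieldI, (0.2)–(0.6) p.176, Prop. 1 p.194, (1.80), (1.89), (1.99)–(1.102); Balaban1989LargeFieldII, Thm 1 + (0.1) pp.355–356 (bookkeeping)] -/
theorem exists_record₁₃CSep_pinWWorld_b15_main_of_leafOfRecord (h : θ.Provisos₁₃Sep F N) (hθ : θ.Admissible F N) (lamW : ResidW F N)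
    {γw : ℝ} (hγw : 0 < γw ∧ γw ≤ θ.γ) (h12 : ∀ P, B15Leaf (WOfRecord₁₃ F N θ lamW P)) :
    ∃ w : WorldP, IsRecordOfRecord₁₃CSep F N (datumOfRecord₁₃Sep F N θ h) w ∧ w.γ = γw ∧ w.L = (θ.L : ℝ) ∧
      (∀ P, w.up P = upOfRecord₅C F N ((θ.pinW F N (WOfRecord₁₃ F N θ lamW)).toStage5₁₃ F N) P) ∧ ∀ P : B12.RunParams, Dag.B15_main (leavesP w P) :=
  exists_record₁₃CSep_pinWWorld_b15_main_of_leaf θ h hθ (WOfRecord₁₃ F N θ lamW) hγw h12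

/-- **A ‴-KEYED PACKAGE READS THE STOREY ALONG `Provisos₁₃.toSep`** (same datum, node00-def-T's `datumOfRecord₁₃Sep_toSep`): from the DEPRECATED, print-STRONGER v1.1 proviso
`h : θ.Provisos₁₃ F N` (displayed in full — the one-way map old ⇒ new; NOT a `Sep ⇒ ‴` face) the v1.2 record of `datumOfRecord₁₃ F N θ h` with `Dag.B15_main` at every run (dag-n10-d's
`…_toSep` convention). [cite: Balaban1989LargeFieldII, Thm 1 + (0.1) pp.355–356; Balaban1989LargeFieldI, (0.2) p.176 (bookkeeping)] -/
theorem exists_record₁₃CSep_pinWWorld_b15_main_of_leafOfRecord_toSep (h : θ.Provisos₁₃ F N) (hθ : θ.Admissible F N) (lamW : ResidW F N)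
    {γw : ℝ} (hγw : 0 < γw ∧ γw ≤ θ.γ) (h12 : ∀ P, B15Leaf (WOfRecord₁₃ F N θ lamW P)) :
    ∃ w : WorldP, IsRecordOfRecord₁₃CSep F N (datumOfRecord₁₃ F N θ h) w ∧ w.γ = γw ∧ w.L = (θ.L : ℝ) ∧
      (∀ P, w.up P = upOfRecord₅C F N ((θ.pinW F N (WOfRecord₁₃ F N θ lamW)).toStage5₁₃ F N) P) ∧ ∀ P : B12.RunParams, Dag.B15_main (leavesP w P) :=
  exists_record₁₃CSep_pinWWorld_b15_main_of_leafOfRecord θ h.toSep hθ lamW hγw h12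

end Storey

section LiveStorey
variable (Θ : Stage13Params F N) (lamW : ResidW F N)

/-- **★ N12's v1.2 STOREY AT THE ₁₃ LIVE RE-PIN OF A PARAMETER CARRYING K0b's RESIDUALS, N12's ROW FROM ITS PER-RUN DISPLAYS** (W read at the bundle of record
`WOfRecord₁₃ (Θ.liveRepin₁₃) λ`; the row by 12E's ★★ `b15Leaf_WOfRecord₁₃_liveRepin₁₃_all_of_massLive_of_hasResiduals`: below the torus the (1.100) pin equation + «every LIVE pre-𝐑 term at
level `kSel P + 1` has positive mass» + Prop. 1 (1.78) + (1.80) + (1.89); on runs with `K ≤ kSel P` the leaf handed).  K1⁗-side input: `h : Provisos₁₃Sep` at the re-pin (for the datum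
and the record predicate ONLY) and admissibility. [cite: Balaban1989LargeFieldI, (0.2)–(0.6) p.176, p.176 ll.14–16, Prop. 1 (1.78) p.194, (1.80) p.195, (1.89) p.198, (1.99)–(1.102) pp.200–201; Balaban1988Convergent, (3.16) p.268, (3.22)–(3.25) pp.269–270; Balaban1989LargeFieldII, Thm 1 + (0.1) pp.355–356] -/
theorem exists_record₁₃CSep_pinWWorld_b15_main_liveRepin₁₃_of_massLive_of_hasResiduals (hres : Θ.HasResidualsOfRecord F N)
    (h : (Θ.liveRepin₁₃ F N).Provisos₁₃Sep F N) (hθ : Θ.Admissible F N) {γw : ℝ} (hγw : 0 < γw ∧ γw ≤ Θ.γ)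
    (h12deg : ∀ P : B12.RunParams, P.K ≤ lamW.kSel P → B15Leaf (WOfRecord₁₃ F N (Θ.liveRepin₁₃ F N) lamW P))
    (h12pin : ∀ P : B12.RunParams, lamW.kSel P < P.K → lamW.D1100 P
      = rPrimeDataOfSel (reprTOfRecord₁₃ F N (Θ.liveRepin₁₃ F N) P (lamW.kSel P))
          ((Θ.liveRepin₁₃ F N).ppSel P (gOfRecord₁₃ F N (Θ.liveRepin₁₃ F N) P) (lamW.kSel P + 1))
          (fibOfSeq F (Θ.liveRepin₁₃ F N).ν (Θ.liveRepin₁₃ F N).τ9 P (gOfRecord₁₃ F N (Θ.liveRepin₁₃ F N) P) (lamW.kSel P + 1)))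
    (h12mass : ∀ P : B12.RunParams, lamW.kSel P < P.K → ∀ s, LiveSeq F N Θ.ν Θ.τ9 P (gOfRecord₁₃ F N (Θ.liveRepin₁₃ F N) P) (lamW.kSel P + 1)
        (slotsTOfRecord F N Θ.ν Θ.τ9 (EOfRecord₁₃ F N (Θ.liveRepin₁₃ F N)) (wOfRecord₉ F N (Θ.liveRepin₁₃ F N).toStage9Params)
          (Θ.liveRepin₁₃ F N).ppSel P (gOfRecord₁₃ F N (Θ.liveRepin₁₃ F N) P) (lamW.kSel P + 1)) s →
      0 < ∫ V, rterm (reprTOfRecord₁₃ F N (Θ.liveRepin₁₃ F N) P (lamW.kSel P)) s V ∂(fieldMeasure (F.P P.K) (lamW.kSel P + 1) (SU N)))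
    (h12P1 : ∀ P : B12.RunParams, lamW.kSel P < P.K → Prop1Printed (lamW.LF P))
    (h12i180 : ∀ P : B12.RunParams, lamW.kSel P < P.K → ∀ U, new189 (lamW.D189 P) U → ∀ i, (lamW.D189 P).h ≤ i → i ≤ (lamW.D189 P).k →
      ∀ q ∈ plaqsOf (dom (lamW.D189 P) i),
        Ineq180 ((lamW.D189 P).dev0 U q) ((lamW.D189 P).ε (lamW.D189 P).k) (lamW.D189 P).η (lamW.D189 P).B₃ (lamW.D189 P).B₅ (lamW.D189 P).M (lamW.D189 P).δ
          ((lamW.D189 P).dist q) (lamW.D189 P).O1)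
    (h12c189 : ∀ P : B12.RunParams, lamW.kSel P < P.K → Claim189 (new189 (lamW.D189 P)) (chiPP (lamW.D189 P))) :
    ∃ w : WorldP, IsRecordOfRecord₁₃CSep F N (datumOfRecord₁₃Sep F N (Θ.liveRepin₁₃ F N) h) w ∧ w.γ = γw ∧ w.L = ((Θ.liveRepin₁₃ F N).L : ℝ) ∧
      (∀ P, w.up P = upOfRecord₅C F N (((Θ.liveRepin₁₃ F N).pinW F N (WOfRecord₁₃ F N (Θ.liveRepin₁₃ F N) lamW)).toStage5₁₃ F N) P) ∧
        ∀ P : B12.RunParams, Dag.B15_main (leavesP w P) :=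
  exists_record₁₃CSep_pinWWorld_b15_main_of_leafOfRecord (Θ.liveRepin₁₃ F N) h hθ.liveRepin₁₃ lamW hγw
    (N12AtRecord13OfResiduals.b15Leaf_WOfRecord₁₃_liveRepin₁₃_all_of_massLive_of_hasResiduals Θ lamW hres h12deg h12pin h12mass h12P1 h12i180 h12c189)

/-- **★★ THE RUNG-1 SHAPE OF THE rev-18 K1⁗ SKELETON (plan g67 `K1Skeleton13Sep.stub_nodes13P`), N12's CONJUNCT ONLY, WITNESSED BY `(Θ.liveRepin₁₃, h, w)` — GUARD AND N12's ROW
THEOREMS OF K0b's RESIDUALS + N12's PER-RUN DISPLAYS**: `∃ θ' h' w, (ZtUnity ∧ SlotsNondegenerate₁₃) ∧ Admissible ∧ IsRecordOfRecord₁₃CSep (datumOfRecord₁₃Sep θ' h') w ∧ ∀ P, Dag.B15_main (leavesP w P)`;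
the guard by K0b ∕ K0a (`HasResidualsOfRecord.ztUnity`, FILE 9 v1.1 `slotsNondegenerate₁₃_liveRepin_of_hasResiduals` — NO proviso read).  N12 ALONE at its own world (the joint rung needs all
thirteen nodes at ONE world: §4's four-pin sockets ∕ dag-n24-c's engine); NOT the stub; count-neutral. [cite: Balaban1989LargeFieldI, (0.2)–(0.6) p.176, Prop. 1 (1.78) p.194, (1.80) p.195, (1.89) p.198, (1.99)–(1.102) pp.200–201; Balaban1988Convergent, (3.16)–(3.22) pp.268–269 (the guard); Balaban1989LargeFieldII, Thm 1 + (0.1) pp.355–356 (bookkeeping)] -/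
theorem exists_guarded_record₁₃CSep_b15_main_liveRepin₁₃_of_massLive_of_hasResiduals (hres : Θ.HasResidualsOfRecord F N)
    (h : (Θ.liveRepin₁₃ F N).Provisos₁₃Sep F N) (hθ : Θ.Admissible F N)
    (h12deg : ∀ P : B12.RunParams, P.K ≤ lamW.kSel P → B15Leaf (WOfRecord₁₃ F N (Θ.liveRepin₁₃ F N) lamW P))
    (h12pin : ∀ P : B12.RunParams, lamW.kSel P < P.K → lamW.D1100 P
      = rPrimeDataOfSel (reprTOfRecord₁₃ F N (Θ.liveRepin₁₃ F N) P (lamW.kSel P))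
          ((Θ.liveRepin₁₃ F N).ppSel P (gOfRecord₁₃ F N (Θ.liveRepin₁₃ F N) P) (lamW.kSel P + 1))
          (fibOfSeq F (Θ.liveRepin₁₃ F N).ν (Θ.liveRepin₁₃ F N).τ9 P (gOfRecord₁₃ F N (Θ.liveRepin₁₃ F N) P) (lamW.kSel P + 1)))
    (h12mass : ∀ P : B12.RunParams, lamW.kSel P < P.K → ∀ s, LiveSeq F N Θ.ν Θ.τ9 P (gOfRecord₁₃ F N (Θ.liveRepin₁₃ F N) P) (lamW.kSel P + 1)
        (slotsTOfRecord F N Θ.ν Θ.τ9 (EOfRecord₁₃ F N (Θ.liveRepin₁₃ F N)) (wOfRecord₉ F N (Θ.liveRepin₁₃ F N).toStage9Params)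
          (Θ.liveRepin₁₃ F N).ppSel P (gOfRecord₁₃ F N (Θ.liveRepin₁₃ F N) P) (lamW.kSel P + 1)) s →
      0 < ∫ V, rterm (reprTOfRecord₁₃ F N (Θ.liveRepin₁₃ F N) P (lamW.kSel P)) s V ∂(fieldMeasure (F.P P.K) (lamW.kSel P + 1) (SU N)))
    (h12P1 : ∀ P : B12.RunParams, lamW.kSel P < P.K → Prop1Printed (lamW.LF P))
    (h12i180 : ∀ P : B12.RunParams, lamW.kSel P < P.K → ∀ U, new189 (lamW.D189 P) U → ∀ i, (lamW.D189 P).h ≤ i → i ≤ (lamW.D189 P).k →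
      ∀ q ∈ plaqsOf (dom (lamW.D189 P) i),
        Ineq180 ((lamW.D189 P).dev0 U q) ((lamW.D189 P).ε (lamW.D189 P).k) (lamW.D189 P).η (lamW.D189 P).B₃ (lamW.D189 P).B₅ (lamW.D189 P).M (lamW.D189 P).δ
          ((lamW.D189 P).dist q) (lamW.D189 P).O1)
    (h12c189 : ∀ P : B12.RunParams, lamW.kSel P < P.K → Claim189 (new189 (lamW.D189 P)) (chiPP (lamW.D189 P))) :
    ∃ (θ' : Stage13Params F N) (h' : θ'.Provisos₁₃Sep F N) (w : WorldP), (θ'.ZtUnity F N ∧ θ'.SlotsNondegenerate₁₃ F N) ∧ θ'.Admissible F N ∧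
      IsRecordOfRecord₁₃CSep F N (datumOfRecord₁₃Sep F N θ' h') w ∧ ∀ P : B12.RunParams, Dag.B15_main (leavesP w P) := by
  obtain ⟨w, hR, -, -, -, hN⟩ := exists_record₁₃CSep_pinWWorld_b15_main_liveRepin₁₃_of_massLive_of_hasResiduals Θ lamW hres h hθ
    ⟨hθ.toStage9.gamma_pos, le_rfl⟩ h12deg h12pin h12mass h12P1 h12i180 h12c189
  exact ⟨Θ.liveRepin₁₃ F N, h, w, ⟨Stage13Params.ZtUnity.liveRepin₁₃ hres.ztUnity, Stage13Params.slotsNondegenerate₁₃_liveRepin_of_hasResiduals hres⟩,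
    hθ.liveRepin₁₃, hR, hN⟩

end LiveStorey

section Thm1CStorey
variable (ε₀ ε₂₉ B₃ a₀ a₁ : ℝ) (lamW : ResidW F N)

/-- **★★★ THE RUNG-1 SHAPE OF THE rev-18 K1⁗ SKELETON, N12's CONJUNCT ONLY, AT THE PLAN's `L`-KEYED WITNESS `θ₁₅ᶜ = theta13OfThm1C F N ε₀ ε₂₉ B₃ a₀ a₁`** (§3 at
`Θ := theta13OfNumerics … (stage12NumericsOfThm1C F.L ε₀ B₃ a₀ a₁) …`, whose ₁₃ live re-pin IS `θ₁₅ᶜ`; K0b's residuals of record by K0a's `hasResidualsOfRecord_theta13OfNumerics`,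
admissibility by K0a's `admissible_theta13OfNumerics` under the five witness signs): K1⁗-SIDE INPUT = `h : Provisos₁₃Sep θ₁₅ᶜ` ALONE (read by the datum and the record predicate only);
N12's per-run displays as in 12E ∕ 12F.  N12 ALONE at its own world; NOT the stub; count-neutral. [cite: Balaban1989LargeFieldI, (0.2)–(0.6) p.176, Prop. 1 (1.78) p.194, (1.80) p.195, (1.89) p.198, (1.99)–(1.102) pp.200–201; Balaban1988Convergent, (2.10) p.256, (3.16)–(3.22) pp.268–269; Balaban1989LargeFieldII, Thm 1 + (0.1) pp.355–356; Balaban1985Variational, Thm 1 p.279 (witness letters only)] -/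
theorem exists_guarded_record₁₃CSep_b15_main_theta13OfThm1C_of_massLive (hε : 0 < ε₀) (hε' : 0 < ε₂₉) (hB : 0 ≤ B₃) (ha₀ : 0 < a₀) (ha₁ : 0 < a₁)
    (h : (theta13OfThm1C F N ε₀ ε₂₉ B₃ a₀ a₁).Provisos₁₃Sep F N)
    (h12deg : ∀ P : B12.RunParams, P.K ≤ lamW.kSel P → B15Leaf (WOfRecord₁₃ F N (theta13OfThm1C F N ε₀ ε₂₉ B₃ a₀ a₁) lamW P))
    (h12pin : ∀ P : B12.RunParams, lamW.kSel P < P.K → lamW.D1100 P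
      = rPrimeDataOfSel (reprTOfRecord₁₃ F N (theta13OfThm1C F N ε₀ ε₂₉ B₃ a₀ a₁) P (lamW.kSel P))
          ((theta13OfThm1C F N ε₀ ε₂₉ B₃ a₀ a₁).ppSel P (gOfRecord₁₃ F N (theta13OfThm1C F N ε₀ ε₂₉ B₃ a₀ a₁) P) (lamW.kSel P + 1))
          (fibOfSeq F (theta13OfThm1C F N ε₀ ε₂₉ B₃ a₀ a₁).ν (theta13OfThm1C F N ε₀ ε₂₉ B₃ a₀ a₁).τ9 P (gOfRecord₁₃ F N (theta13OfThm1C F N ε₀ ε₂₉ B₃ a₀ a₁) P) (lamW.kSel P + 1)))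
    (h12mass : ∀ P : B12.RunParams, lamW.kSel P < P.K → ∀ s, LiveSeq F N (theta13OfThm1C F N ε₀ ε₂₉ B₃ a₀ a₁).ν (theta13OfThm1C F N ε₀ ε₂₉ B₃ a₀ a₁).τ9 P (gOfRecord₁₃ F N (theta13OfThm1C F N ε₀ ε₂₉ B₃ a₀ a₁) P) (lamW.kSel P + 1)
        (slotsTOfRecord F N (theta13OfThm1C F N ε₀ ε₂₉ B₃ a₀ a₁).ν (theta13OfThm1C F N ε₀ ε₂₉ B₃ a₀ a₁).τ9 (EOfRecord₁₃ F N (theta13OfThm1C F N ε₀ ε₂₉ B₃ a₀ a₁)) (wOfRecord₉ F N (theta13OfThm1C F N ε₀ ε₂₉ B₃ a₀ a₁).toStage9Params)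
          (theta13OfThm1C F N ε₀ ε₂₉ B₃ a₀ a₁).ppSel P (gOfRecord₁₃ F N (theta13OfThm1C F N ε₀ ε₂₉ B₃ a₀ a₁) P) (lamW.kSel P + 1)) s →
      0 < ∫ V, rterm (reprTOfRecord₁₃ F N (theta13OfThm1C F N ε₀ ε₂₉ B₃ a₀ a₁) P (lamW.kSel P)) s V ∂(fieldMeasure (F.P P.K) (lamW.kSel P + 1) (SU N)))
    (h12P1 : ∀ P : B12.RunParams, lamW.kSel P < P.K → Prop1Printed (lamW.LF P))
    (h12i180 : ∀ P : B12.RunParams, lamW.kSel P < P.K → ∀ U, new189 (lamW.D189 P) U → ∀ i, (lamW.D189 P).h ≤ i → i ≤ (lamW.D189 P).k →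
      ∀ q ∈ plaqsOf (dom (lamW.D189 P) i),
        Ineq180 ((lamW.D189 P).dev0 U q) ((lamW.D189 P).ε (lamW.D189 P).k) (lamW.D189 P).η (lamW.D189 P).B₃ (lamW.D189 P).B₅ (lamW.D189 P).M (lamW.D189 P).δ
          ((lamW.D189 P).dist q) (lamW.D189 P).O1)
    (h12c189 : ∀ P : B12.RunParams, lamW.kSel P < P.K → Claim189 (new189 (lamW.D189 P)) (chiPP (lamW.D189 P))) :
    ∃ (θ' : Stage13Params F N) (h' : θ'.Provisos₁₃Sep F N) (w : WorldP), (θ'.ZtUnity F N ∧ θ'.SlotsNondegenerate₁₃ F N) ∧ θ'.Admissible F N ∧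
      IsRecordOfRecord₁₃CSep F N (datumOfRecord₁₃Sep F N θ' h') w ∧ ∀ P : B12.RunParams, Dag.B15_main (leavesP w P) :=
  exists_guarded_record₁₃CSep_b15_main_liveRepin₁₃_of_massLive_of_hasResiduals
    (theta13OfNumerics F N (stage12NumericsOfThm1C F.L ε₀ B₃ a₀ a₁) ε₂₉
      (zeta316OfRecord F N (stage12NumericsOfThm1C F.L ε₀ B₃ a₀ a₁).ν (stage12NumericsOfThm1C F.L ε₀ B₃ a₀ a₁).τ9.M (stage12NumericsOfThm1C F.L ε₀ B₃ a₀ a₁).A₁)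
      (RzOfRecord F N) (ZtOfRecord F N)) lamW
    (hasResidualsOfRecord_theta13OfNumerics F N (stage12NumericsOfThm1C F.L ε₀ B₃ a₀ a₁) ε₂₉) h
    (admissible_theta13OfNumerics F N (zeta316OfRecord F N (stage12NumericsOfThm1C F.L ε₀ B₃ a₀ a₁).ν (stage12NumericsOfThm1C F.L ε₀ B₃ a₀ a₁).τ9.M
      (stage12NumericsOfThm1C F.L ε₀ B₃ a₀ a₁).A₁) (RzOfRecord F N) (ZtOfRecord F N) (stage12NumericsOfThm1C_pos hε hB ha₀ ha₁) hε')
    h12deg h12pin h12mass h12P1 h12i180 h12c189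

end Thm1CStorey

end Summit.QuantumFields.YangMills.BalabanUVNodes.N12AtRecord13Sep
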